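/-
Copyright (c) 2026 the pub-hodgecm-mathlib formalisation cell (harness21).  Prover seat hodgecm-mathlib-R90-IF-p04 (g3), programme R90-TF, section S9 «InnerForm-13.3.6 (c)»,
deal «(tw-close) ORGAN PART 1» (R90-IF-plan (g2), R90 bus 2026-09-05T03:04:30Z; HEADS 03:14:14Z).
-/
import Literature.NumberTheory.Rogawski1990.PureTensorEvalFactors               -- ★ p864858 (this seat): factor rigidity of pure tensors (`exists_loc_eq_smul_of_eval_eq`, `forall_eval_eq_zero_iff`, …)
import Literature.NumberTheory.Automorphic.SphericalEigencharacterStarCharacter   -- ★ `IsLevel.mulConv` (+ ★ `mulConv`, `hasCompactSupport_mulConv` in its cone)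
import Literature.NumberTheory.Automorphic.AutomorphicQuotientDiagonalTracePolar  -- ★ `mulConv_smul_left`
import HarnessLib

/-!
# R90-TF · S9 «InnerForm-13.3.6 (c)» — (tw-close) ORGAN PART 1: the HECKE TWIST and the TRANSPORT of a restricted pure tensor as honest
# constructions, and the law that makes the twist well defined ON FUNCTIONS: two factorisations of one function twist alike
# (Rogawski 1990 §13.7 p. 206, §14.2 p. 233, §14.6 p. 242; Borel–Jacquet 1979 §4.1; Flath 1979 §2–§3; Cartier 1979 §IV.1)

Cell `hodgecm-mathlib`, crux H413 (`stmt-HodgeConjecture-24833`, lane `--supports … --as helper`), route of record `HCCMUnconditional` (no route verbs; count-neutral).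
Programme R90-TF (brief `director/R90-BRIEF.v2.md` 1f40d54518340a35), section S9 = InnerForm-13.3.6 (c) (base `R90-IF`); seat R90-IF-p04 (g3); ED. 5 material
(design: `R90/R90-IF-p04/g3/CENSUS-tw-close.R90-IF-p04-g3.md`).  X-GENERIC: `L` CM, `H, H′ ∈ M_N(L)`, no `X_cm`, no kit, no Lines import.

WHY.  FILE B ED. 4 v0.1 (`Cruxes/H413/Lines/R90_S9_InnerFormTransportB.lean`, cand 9c821f62) carries the Hecke-twist map `tw` of the quasi-split side as
∃-DATA of its record-datum producer, with the laws `hTw` (a twist of a transfer is a transfer of the twist) and `hEP` (the eigen-law) as producer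
CONJUNCTS (payers S3∕S7).  Since the kit's `Transfer` is PINNED to transport along `ψ_v` at every finite place (★ `PinTransferIff`: `T′.loc v =
T.loc v ∘ (ψ v)⁻¹`), `tw` CAN be closed S9-side as «twist the finite factors of the transfer's own pure tensor by the transported Hecke kernels»
— provided that twisting a FUNCTION through a chosen factorisation does not depend on the factorisation.  This file gives the two honest
constructions and that law:
* §1 **`twistAt T 𝒯 k μ`** — the pure tensor `T` with its local factor CONVOLVED with `k_v` (w.r.t. `μ_v`, ★ `mulConv`) at the places `v ∈ 𝒯` and
  unchanged elsewhere (bad set `T.S ∪ 𝒯`, same levels, same archimedean factor) = B's `InnerFormSec146.twistTest l F` on the tensor side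
  (`𝒯 := F.T`, `k := F.loc`, `μ := νG`); rfl-API; `twistAt_isUnramified`; `twistAt_isTest` (factors stay in `C_c^∞`: ★ `IsLevel.mulConv`,
  ★ `hasCompactSupport_mulConv`, as in ★ `isLevelTest_twistTest`).
* §2 **`transportAlong ψ S₀ T φ′`** — the tensor on `U(H′)` with finite factors `T.loc v ∘ (ψ v)⁻¹`, levels `ψ_v(T.K v)`, bad set `T.S ∪ S₀` and a
  GIVEN archimedean factor `φ′` (the kit's archimedean transfer is not functional — census (2)); rfl-API; `transportAlong_isUnramified` under the
  level-matching pin `ψ_v(g) ∈ K_{H′,v} ↔ g ∈ K_{H,v}` off `S₀`.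
* §3 **SCALAR FAMILIES**: `eval_eq_of_superset` (read `eval` on any finite `S′ ⊇ T.S` for unramified `T`); `eval_eq_mul_eval_of_loc_eq_smul` — if
  `B.loc v = c_v • A.loc v` (all `v`) and `B.arch = c_∞ • A.arch` for unramified `A, B`, then `B.eval = (c_∞ · ∏_{A.S ∪ B.S} c_v) • A.eval`.
* §4 **THE ORGAN'S HEART — `eval_twistAt_eq_of_eval_eq`**: for unramified `T₁, T₂` with `T₁.eval = T₂.eval`, `(twistAt T₁ 𝒯 k μ).eval =
  (twistAt T₂ 𝒯 k μ).eval` — non-zero case by ★ p864858's proportionality (`exists_loc_eq_smul_of_eval_eq`, `exists_arch_eq_smul_of_eval_eq`) +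
  `mulConv_smul_left` + §3 (the scalar `c_∞ ∏ c_v` is `1` because it is `1` before twisting and the twist does not change it); zero case by
  ★ `forall_eval_eq_zero_iff` (a vanishing factor survives the twist: `mulConv μ 0 k = 0`).
* §5 **TRANSPORT OF CONVOLUTION and THE TWIST COMMUTES WITH THE TRANSPORT**: `mulConv_map_comp_symm` — `mulConv (ψ_* ν) (f ∘ ψ⁻¹) (k ∘ ψ⁻¹) =
  mulConv ν f k ∘ ψ⁻¹` for `ψ : G ≃ₜ* G′`; `transportAlong_twistAt_loc` — `(transportAlong ψ S₀ (twistAt T 𝒯 k μ) φ′).loc v = (twistAt (transportAlong ψ S₀ T φ′) 𝒯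
  (k · ∘ ψ⁻¹) (ψ_* μ)).loc v` (the local content of `hTw` once `Transfer` is transport along `ψ`).
CUT-LINES for PART 2 (successor): `transportTwist ψ S₀ νG l h f := (twistAt T′_f h.T (h.loc · ∘ (ψ ·)⁻¹) ((νG ·).map (ψ ·))).toCc` over a CHOSEN
test factorisation `T′_f` of `f` (well defined by §4 + §5), and `hTw_of_pinTransfer` in the binder shape of v0.1 :1394 (Smooth-half = `twistAt_isTest`
+ ★ `smooth_cm_twistTest`; Transfer-half = §5 + the pin `T′.loc v = T.loc v ∘ ψ⁻¹` + ★ `isKcBiInv_tensOfPair`; the U(H)-side identity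
`tensOfPair (twistTest l F p) = (twistAt T_p F.T F.loc νG).eval` for the canonical tensor `T_p` of a pair).
THEOREMS + two honest `def`s (no instance, no notation, no named fact, no `sorry`); axioms TRIO.  HONEST LABEL: HC_CM is proved only modulo the 7 printed
citations (2 remaining named inputs: hLiu418 = stmt-HodgeConjecture-24832, h413 = stmt-HodgeConjecture-24833) until rung 0 closes; an organ pays no socket
until an edition consumes it; REL ≠ ★ ≠ BUILT.

## References
[cite: Rogawski1990, §13.7 p. 206; §14.2 p. 233; §14.6 p. 242 l. 10–22] [cite: BorelJacquet1979, §4.1] [cite: Flath1979, §2–§3] [cite: CartierCorvallis1979, §IV.1]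
-/

set_option autoImplicit false
set_option linter.dupNamespace false  -- the mandated namespace repeats the summit's segment (`HodgeConjecture.HodgeConjecture`)

noncomputable section

open NumberField IsDedekindDomain MeasureTheory
open scoped Classical
open Literature.NumberTheory.Automorphic Literature.NumberTheory.Automorphic.UnitaryGroup

namespace Summit.HodgeConjecture.HodgeConjecture.R90.S9.PureTensorTwist

variable {L : Type} [Field L] [NumberField L] [IsCMField L] {N : ℕ} {H H' : Matrix (Fin N) (Fin N) L}

/-! ## §1 The Hecke twist of a pure tensor at a finite set of places -/

/-- **`twistAt T 𝒯 k μ` — THE HECKE TWIST OF A PURE TENSOR**: at the places `v ∈ 𝒯` the local factor `T.loc v` is replaced by the convolution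
`T.loc v ⋆ k_v = mulConv (μ v) (T.loc v) (k v)` (★ `mulConv`: `(f ⋆ k)(g) = ∫ f(u) k(u⁻¹ g) dμ(u)`), the other factors, the levels and the
archimedean factor are unchanged; the bad set becomes `T.S ∪ 𝒯`.  (B's `twistTest l F (φ, f) = (φ, v ↦ if v ∈ F.T then f_v ⋆ F_v else f_v)` on the
tensor side.) [cite: Rogawski1990, §13.7 p. 206; §14.6 p. 242 l. 10–22] [cite: CartierCorvallis1979, §IV.1] -/
def twistAt (T : PureTensor L N H) (𝒯 : Finset (HeightOneSpectrum (𝓞 ↥(maximalRealSubfield L))))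
    (k : ∀ v : HeightOneSpectrum (𝓞 ↥(maximalRealSubfield L)), (cmDatum L N H).Local v → ℂ)
    (μ : ∀ v : HeightOneSpectrum (𝓞 ↥(maximalRealSubfield L)), @Measure ((cmDatum L N H).Local v) (borel _)) : PureTensor L N H where
  S := T.S ∪ 𝒯
  K := T.K
  loc v := if v ∈ 𝒯 then (letI : MeasurableSpace ((cmDatum L N H).Local v) := borel _; mulConv (μ v) (T.loc v) (k v)) else T.loc v
  arch := T.arch
  loc_eq_indicator v hv := by
    rw [Finset.mem_union, not_or] at hv
    rw [if_neg hv.2]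
    exact T.loc_eq_indicator v hv.1

section TwistAPI

variable (T : PureTensor L N H) (𝒯 : Finset (HeightOneSpectrum (𝓞 ↥(maximalRealSubfield L))))
  (k : ∀ v : HeightOneSpectrum (𝓞 ↥(maximalRealSubfield L)), (cmDatum L N H).Local v → ℂ)
  (μ : ∀ v : HeightOneSpectrum (𝓞 ↥(maximalRealSubfield L)), @Measure ((cmDatum L N H).Local v) (borel _))

/-- Bad set of the twist: `T.S ∪ 𝒯` (rfl). [cite: Rogawski1990, §13.7 p. 206] -/
@[simp] theorem twistAt_S : (twistAt T 𝒯 k μ).S = T.S ∪ 𝒯 := rfl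

/-- Levels of the twist: unchanged (rfl). [cite: Rogawski1990, §13.7 p. 206] -/
@[simp] theorem twistAt_K : (twistAt T 𝒯 k μ).K = T.K := rfl

/-- Archimedean factor of the twist: unchanged (rfl). [cite: Rogawski1990, §14.6 p. 242] -/
@[simp] theorem twistAt_arch : (twistAt T 𝒯 k μ).arch = T.arch := rfl

/-- Local factor of the twist at a twisted place: the convolution. [cite: Rogawski1990, §13.7 p. 206] -/
theorem twistAt_loc_of_mem {v : HeightOneSpectrum (𝓞 ↥(maximalRealSubfield L))} (hv : v ∈ 𝒯) :
    (twistAt T 𝒯 k μ).loc v = (letI : MeasurableSpace ((cmDatum L N H).Local v) := borel _; mulConv (μ v) (T.loc v) (k v)) := by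
  show (if v ∈ 𝒯 then _ else _) = _
  rw [if_pos hv]

/-- Local factor of the twist off the twisted places: unchanged. [cite: Rogawski1990, §13.7 p. 206] -/
theorem twistAt_loc_of_not_mem {v : HeightOneSpectrum (𝓞 ↥(maximalRealSubfield L))} (hv : v ∉ 𝒯) :
    (twistAt T 𝒯 k μ).loc v = T.loc v := by
  show (if v ∈ 𝒯 then _ else _) = _
  rw [if_neg hv]

/-- The twist of an unramified tensor is unramified (its levels off the bigger bad set are still the integral levels). [cite: Rogawski1990, §14.2 p. 233] -/
theorem twistAt_isUnramified (hT : T.IsUnramified) : (twistAt T 𝒯 k μ).IsUnramified := fun v hv => by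
  rw [twistAt_S, Finset.mem_union, not_or] at hv
  exact hT v hv.1

/-- **The twist of a TEST tensor by compactly supported bi-`K_v`-invariant kernels is a TEST tensor** (for left-invariant `μ_v` and factors of `T`
bi-`K_v`-invariant at the twisted places — as for level tests off the level): the new factors are bi-`K_v`-invariant (★ `IsLevel.mulConv`), hence
locally constant, and compactly supported (★ `hasCompactSupport_mulConv`). [cite: CartierCorvallis1979, §IV.1] [cite: BorelJacquet1979, §4.1] -/
theorem twistAt_isTest (hT : T.IsTest)
    (hleft : ∀ v, letI : MeasurableSpace ((cmDatum L N H).Local v) := borel _; (μ v).IsMulLeftInvariant)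
    (hf : ∀ v ∈ 𝒯, IsLevel (cmLocalIntegralLevel L N H v) (T.loc v))
    (hk : ∀ v ∈ 𝒯, IsLevel (cmLocalIntegralLevel L N H v) (k v) ∧ HasCompactSupport (k v)) :
    (twistAt T 𝒯 k μ).IsTest := by
  refine ⟨twistAt_isUnramified T 𝒯 k μ hT.isUnramified, fun v hv => ?_, hT.isArchTest⟩
  rw [twistAt_S, Finset.mem_union] at hv
  by_cases hv𝒯 : v ∈ 𝒯
  · letI : MeasurableSpace ((cmDatum L N H).Local v) := borel _
    haveI : BorelSpace ((cmDatum L N H).Local v) := ⟨rfl⟩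
    haveI := hleft v
    have hlev : IsLevel (cmLocalIntegralLevel L N H v) (mulConv (μ v) (T.loc v) (k v)) := (hf v hv𝒯).mulConv (μ v) (hk v hv𝒯).1
    rw [twistAt_loc_of_mem T 𝒯 k μ hv𝒯]
    refine ⟨hlev.isLocallyConstant, hasCompactSupport_mulConv (μ v) ?_ (hk v hv𝒯).2⟩
    by_cases hvS : v ∈ T.S
    · exact (hT.isFinSmooth v hvS).2
    · exact PureTensor.hasCompactSupport_loc hT.isUnramified hT.isFinSmooth v
  · rw [twistAt_loc_of_not_mem T 𝒯 k μ hv𝒯]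
    exact hT.isFinSmooth v (hv.resolve_right hv𝒯)

end TwistAPI

/-! ## §2 The transport of a pure tensor along local identifications `ψ_v : U(H)(L⁺_v) ≃ U(H′)(L⁺_v)` -/

/-- **`transportAlong ψ S₀ T φ′` — THE TRANSPORT OF A PURE TENSOR TO `U(H′)`**: finite factors `T.loc v ∘ (ψ v)⁻¹`, levels `ψ_v(T.K v)`, bad set
`T.S ∪ S₀` (`S₀` = the places where the identifications need not match the integral levels), and a GIVEN archimedean factor `φ′` on `U(H′)(L⁺ ⊗ ℝ)`
(the kit's archimedean transfer is by orbital integrals, not functional).  This is the `T′` of ★ `PinTransferIff` («`T′.loc v = T.loc v ∘ (𝔨.ψ v).symm`»).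
[cite: Rogawski1990, §14.2 p. 233] [cite: BorelJacquet1979, §4.1] -/
def transportAlong (ψ : ∀ v : HeightOneSpectrum (𝓞 ↥(maximalRealSubfield L)), (cmDatum L N H).Local v ≃ₜ* (cmDatum L N H').Local v)
    (S₀ : Finset (HeightOneSpectrum (𝓞 ↥(maximalRealSubfield L)))) (T : PureTensor L N H)
    (φ' : UnitaryGroup.arch (↥(maximalRealSubfield L)) L (IsCMField.complexConj L) N H' → ℂ) : PureTensor L N H' where
  S := T.S ∪ S₀
  K v := (T.K v).map (ψ v).toMonoidHom
  loc v := T.loc v ∘ (ψ v).symm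
  arch := φ'
  loc_eq_indicator v hv := by
    rw [Finset.mem_union, not_or] at hv
    funext g
    rw [Function.comp_apply, T.loc_eq_indicator v hv.1]
    by_cases hg : (ψ v).symm g ∈ T.K v
    · rw [Set.indicator_of_mem (show (ψ v).symm g ∈ (T.K v : Set ((cmDatum L N H).Local v)) from hg),
        Set.indicator_of_mem]
      exact ⟨(ψ v).symm g, hg, (ψ v).apply_symm_apply g⟩
    · rw [Set.indicator_of_notMem (show (ψ v).symm g ∉ (T.K v : Set ((cmDatum L N H).Local v)) from hg),
        Set.indicator_of_notMem]
      rintro ⟨x, hx, hxg⟩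
      apply hg
      have : x = (ψ v).symm g := by rw [← hxg]; exact ((ψ v).symm_apply_apply x).symm
      exact this ▸ hx

section TransportAPI

variable (ψ : ∀ v : HeightOneSpectrum (𝓞 ↥(maximalRealSubfield L)), (cmDatum L N H).Local v ≃ₜ* (cmDatum L N H').Local v)
  (S₀ : Finset (HeightOneSpectrum (𝓞 ↥(maximalRealSubfield L)))) (T : PureTensor L N H)
  (φ' : UnitaryGroup.arch (↥(maximalRealSubfield L)) L (IsCMField.complexConj L) N H' → ℂ)

/-- Bad set of the transport: `T.S ∪ S₀` (rfl). [cite: Rogawski1990, §14.2 p. 233] -/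
@[simp] theorem transportAlong_S : (transportAlong ψ S₀ T φ').S = T.S ∪ S₀ := rfl

/-- Finite factors of the transport: `T.loc v ∘ (ψ v)⁻¹` (rfl). [cite: Rogawski1990, §14.2 p. 233] -/
@[simp] theorem transportAlong_loc (v : HeightOneSpectrum (𝓞 ↥(maximalRealSubfield L))) :
    (transportAlong ψ S₀ T φ').loc v = T.loc v ∘ (ψ v).symm := rfl

/-- Archimedean factor of the transport: the given `φ′` (rfl). [cite: Rogawski1990, §14.2 p. 233] -/
@[simp] theorem transportAlong_arch : (transportAlong ψ S₀ T φ').arch = φ' := rfl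

/-- Levels of the transport: `ψ_v(T.K v)` (rfl). [cite: Rogawski1990, §14.2 p. 233] -/
theorem transportAlong_K (v : HeightOneSpectrum (𝓞 ↥(maximalRealSubfield L))) :
    (transportAlong ψ S₀ T φ').K v = (T.K v).map (ψ v).toMonoidHom := rfl

/-- **The transport of an unramified tensor is unramified** when the identifications match the integral levels off `S₀`
(`ψ_v(g) ∈ K_{H′,v} ↔ g ∈ K_{H,v}`, the kit's level-matching pin). [cite: Rogawski1990, §14.2 p. 233] -/
theorem transportAlong_isUnramified (hT : T.IsUnramified)
    (hψ : ∀ v ∉ S₀, ∀ g : (cmDatum L N H).Local v, ψ v g ∈ cmLocalIntegralLevel L N H' v ↔ g ∈ cmLocalIntegralLevel L N H v) :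
    (transportAlong ψ S₀ T φ').IsUnramified := by
  intro v hv
  rw [transportAlong_S, Finset.mem_union, not_or] at hv
  rw [transportAlong_K, hT v hv.1]
  ext g
  constructor
  · rintro ⟨x, hx, rfl⟩
    exact (hψ v hv.2 x).2 hx
  · intro hg
    refine ⟨(ψ v).symm g, (hψ v hv.2 _).1 ?_, (ψ v).apply_symm_apply g⟩
    rw [(ψ v).apply_symm_apply]
    exact hg

end TransportAPI

/-! ## §3 Reading `eval` on a bigger finite set; scalar families of factors -/

/-- **`eval` READ ON ANY `S′ ⊇ T.S`** (unramified `T`): `T.eval g = [∀ v ∉ S′, g_v ∈ K_v] · T.arch g_∞ · ∏_{v ∈ S′} T.loc v g_v` — the factors on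
`S′ ∖ T.S` are the indicators `𝟙_{K_v}` and absorb the membership conditions there. [cite: BorelJacquet1979, §4.1] -/
theorem eval_eq_of_superset (T : PureTensor L N H) (hT : T.IsUnramified) {S' : Finset (HeightOneSpectrum (𝓞 ↥(maximalRealSubfield L)))}
    (hS : T.S ⊆ S') (g : (cmDatum L N H).Adelic) :
    T.eval g = if ∀ v ∉ S', (cmDatum L N H).toLocal v g ∈ cmLocalIntegralLevel L N H v then
      T.arch (archPart (↥(maximalRealSubfield L)) L (IsCMField.complexConj L) N H g) * ∏ v ∈ S', T.loc v ((cmDatum L N H).toLocal v g) else 0 := by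
  by_cases hcond : ∀ v ∉ T.S, (cmDatum L N H).toLocal v g ∈ T.K v
  · -- unramified off `T.S`: the extra factors are `1`
    have hcond' : ∀ v ∉ S', (cmDatum L N H).toLocal v g ∈ cmLocalIntegralLevel L N H v := fun v hv =>
      hT v (fun h => hv (hS h)) ▸ hcond v (fun h => hv (hS h))
    rw [PureTensor.eval_eq_of_forall_mem T g hcond, if_pos hcond', ← Finset.prod_sdiff hS]
    have h1 : ∏ v ∈ S' \ T.S, T.loc v ((cmDatum L N H).toLocal v g) = 1 :=
      Finset.prod_eq_one fun v hv => by
        rw [Finset.mem_sdiff] at hv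
        exact PureTensor.loc_apply_of_mem T hv.2 (hcond v hv.2)
    rw [h1, one_mul]
  · obtain ⟨w, hw, hwK⟩ := not_forall₂.1 hcond
    rw [PureTensor.eval_eq_zero_of_not_mem T g hw hwK]
    by_cases hwS : w ∈ S'
    · -- the factor at `w ∈ S′ ∖ T.S` is the indicator, and it vanishes
      split_ifs with hc
      · rw [Finset.prod_eq_zero hwS (PureTensor.loc_apply_of_not_mem T hw hwK), mul_zero]
      · rfl
    · have hc : ¬ ∀ v ∉ S', (cmDatum L N H).toLocal v g ∈ cmLocalIntegralLevel L N H v := fun h =>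
        hwK (hT w hw ▸ h w hwS)
      rw [if_neg hc]

/-- **SCALAR FAMILIES OF FACTORS GIVE A SCALAR MULTIPLE OF `eval`**: for unramified `A, B` with `B.loc v = c_v • A.loc v` at every `v` and
`B.arch = c_∞ • A.arch`, `B.eval g = (c_∞ · ∏_{v ∈ A.S ∪ B.S} c_v) · A.eval g`. [cite: Flath1979, §2] [cite: BorelJacquet1979, §4.1] -/
theorem eval_eq_mul_eval_of_loc_eq_smul (A B : PureTensor L N H) (hA : A.IsUnramified) (hB : B.IsUnramified)
    (c : HeightOneSpectrum (𝓞 ↥(maximalRealSubfield L)) → ℂ) (cinf : ℂ) (hloc : ∀ v, B.loc v = c v • A.loc v) (harch : B.arch = cinf • A.arch)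
    (g : (cmDatum L N H).Adelic) :
    B.eval g = (cinf * ∏ v ∈ A.S ∪ B.S, c v) * A.eval g := by
  rw [eval_eq_of_superset A hA (Finset.subset_union_left : A.S ⊆ A.S ∪ B.S) g,
    eval_eq_of_superset B hB (Finset.subset_union_right : B.S ⊆ A.S ∪ B.S) g]
  split_ifs with hc
  · rw [harch, Pi.smul_apply, smul_eq_mul, Finset.prod_congr rfl fun v _ => by rw [hloc v, Pi.smul_apply, smul_eq_mul],
      Finset.prod_mul_distrib]
    ring
  · rw [mul_zero]

/-! ## §4 The organ's heart: two factorisations of one function twist alike -/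

/-- Off both bad sets the proportionality constant of two unramified factorisations is `1` (both factors are `𝟙_{K_v}`, which is not the zero
function). [cite: Flath1979, §2] -/
theorem smul_const_eq_one_of_not_mem (A B : PureTensor L N H) (hA : A.IsUnramified) (hB : B.IsUnramified)
    {v : HeightOneSpectrum (𝓞 ↥(maximalRealSubfield L))} (hvA : v ∉ A.S) (hvB : v ∉ B.S) {c : ℂ} (hc : B.loc v = c • A.loc v) : c = 1 := by
  have h1 := congrFun hc 1
  rw [hA.loc_eq hvA, hB.loc_eq hvB, Pi.smul_apply, smul_eq_mul,
    Set.indicator_of_mem (show (1 : (cmDatum L N H).Local v) ∈ (cmLocalIntegralLevel L N H v : Set ((cmDatum L N H).Local v)) from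
      Subgroup.one_mem _)] at h1
  simpa using h1.symm

/-- **TWO FACTORISATIONS OF ONE FUNCTION TWIST ALIKE** — the law that makes the Hecke twist well defined on FUNCTIONS (and hence lets `tw` be a
closed term in FILE B): for unramified `T₁, T₂` with `T₁.eval = T₂.eval`, `(twistAt T₁ 𝒯 k μ).eval = (twistAt T₂ 𝒯 k μ).eval`.  Non-zero case:
the factors are placewise proportional (★ `exists_loc_eq_smul_of_eval_eq`, `exists_arch_eq_smul_of_eval_eq`), convolution is linear
(★ `mulConv_smul_left`), the constants off `T₁.S ∪ T₂.S` are `1`, and the total scalar is `1` because it is `1` before twisting (§3 twice);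
zero case: a vanishing factor survives the twist (★ `forall_eval_eq_zero_iff`, `mulConv μ 0 k = 0`).
[cite: Flath1979, §2–§3] [cite: Rogawski1990, §13.7 p. 206; §14.6 p. 242 l. 10–22] [cite: CartierCorvallis1979, §IV.1] -/
theorem eval_twistAt_eq_of_eval_eq (T₁ T₂ : PureTensor L N H) (h₁ : T₁.IsUnramified) (h₂ : T₂.IsUnramified) (h : T₁.eval = T₂.eval)
    (𝒯 : Finset (HeightOneSpectrum (𝓞 ↥(maximalRealSubfield L))))
    (k : ∀ v : HeightOneSpectrum (𝓞 ↥(maximalRealSubfield L)), (cmDatum L N H).Local v → ℂ)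
    (μ : ∀ v : HeightOneSpectrum (𝓞 ↥(maximalRealSubfield L)), @Measure ((cmDatum L N H).Local v) (borel _)) :
    (twistAt T₁ 𝒯 k μ).eval = (twistAt T₂ 𝒯 k μ).eval := by
  by_cases hz : ∀ g : (cmDatum L N H).Adelic, T₁.eval g = 0
  · -- ZERO CASE: a factor of `T₁` (and of `T₂`) vanishes identically, and survives the twist
    have hz2 : ∀ g : (cmDatum L N H).Adelic, T₂.eval g = 0 := fun g => h ▸ hz g
    have key : ∀ T : PureTensor L N H, (∀ g : (cmDatum L N H).Adelic, T.eval g = 0) → ∀ g, (twistAt T 𝒯 k μ).eval g = 0 := by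
      intro T hT
      rcases (PureTensor.forall_eval_eq_zero_iff T).1 hT with harch | ⟨v, hv, hloc⟩
      · exact (PureTensor.forall_eval_eq_zero_iff _).2 (Or.inl harch)
      · refine (PureTensor.forall_eval_eq_zero_iff _).2 (Or.inr ⟨v, Finset.mem_union_left _ hv, fun x => ?_⟩)
        have h0 : T.loc v = 0 := funext hloc
        by_cases hv𝒯 : v ∈ 𝒯
        · rw [twistAt_loc_of_mem T 𝒯 k μ hv𝒯, h0]
          letI : MeasurableSpace ((cmDatum L N H).Local v) := borel _
          rw [mulConv_apply]
          simp only [Pi.zero_apply, zero_mul, integral_zero]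
        · rw [twistAt_loc_of_not_mem T 𝒯 k μ hv𝒯, h0, Pi.zero_apply]
    funext g
    rw [key T₁ hz g, key T₂ hz2 g]
  · -- NON-ZERO CASE: placewise proportional factors
    obtain ⟨g₀, hg₀⟩ := not_forall.1 hz
    have hc := fun v => PureTensor.exists_loc_eq_smul_of_eval_eq T₁ T₂ h hg₀ v
    choose c hc0 hc using hc
    obtain ⟨cinf, -, hcinf⟩ := PureTensor.exists_arch_eq_smul_of_eval_eq T₁ T₂ h hg₀
    -- the scalar is `1` before twisting
    have hκ : (cinf * ∏ v ∈ T₁.S ∪ T₂.S, c v) = 1 := by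
      have e := eval_eq_mul_eval_of_loc_eq_smul T₁ T₂ h₁ h₂ c cinf hc hcinf g₀
      rw [← h] at e
      exact (mul_right_cancel₀ hg₀ ((one_mul _).trans e)).symm
    -- the twisted factors are proportional with the SAME constants
    have hcT : ∀ v, (twistAt T₂ 𝒯 k μ).loc v = c v • (twistAt T₁ 𝒯 k μ).loc v := fun v => by
      by_cases hv : v ∈ 𝒯
      · letI : MeasurableSpace ((cmDatum L N H).Local v) := borel _
        rw [twistAt_loc_of_mem T₂ 𝒯 k μ hv, twistAt_loc_of_mem T₁ 𝒯 k μ hv, hc v]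
        exact mulConv_smul_left (μ v) (c v) (T₁.loc v) (k v)
      · rw [twistAt_loc_of_not_mem T₂ 𝒯 k μ hv, twistAt_loc_of_not_mem T₁ 𝒯 k μ hv, hc v]
    have hκ' : (cinf * ∏ v ∈ (twistAt T₁ 𝒯 k μ).S ∪ (twistAt T₂ 𝒯 k μ).S, c v) = 1 := by
      rw [twistAt_S, twistAt_S, show T₁.S ∪ 𝒯 ∪ (T₂.S ∪ 𝒯) = (T₁.S ∪ T₂.S) ∪ 𝒯 by
        ext v; simp only [Finset.mem_union]; tauto]
      rw [← Finset.union_sdiff_self_eq_union, Finset.prod_union Finset.disjoint_sdiff, ← mul_assoc, hκ, one_mul]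
      exact Finset.prod_eq_one fun v hv => by
        rw [Finset.mem_sdiff, Finset.mem_union, not_or] at hv
        exact smul_const_eq_one_of_not_mem T₁ T₂ h₁ h₂ hv.2.1 hv.2.2 (hc v)
    funext g
    rw [eval_eq_mul_eval_of_loc_eq_smul (twistAt T₁ 𝒯 k μ) (twistAt T₂ 𝒯 k μ) (twistAt_isUnramified T₁ 𝒯 k μ h₁)
      (twistAt_isUnramified T₂ 𝒯 k μ h₂) c cinf hcT (by rw [twistAt_arch, twistAt_arch, hcinf]) g, hκ', one_mul]

/-! ## §5 Transport of convolution along a local identification; the twist commutes with the transport -/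

/-- **CONVOLUTION TRANSPORTS ALONG A GROUP ISOMORPHISM**: for `ψ : G ≃ₜ* G′` (Borel structures) and a measure `ν` on `G`,
`mulConv (ψ_* ν) (f ∘ ψ⁻¹) (k ∘ ψ⁻¹) = (mulConv ν f k) ∘ ψ⁻¹` (change of variables `u = ψ u₀`, ★ `MeasureTheory.integral_map_equiv`).
[cite: CartierCorvallis1979, §IV.1] [cite: Rogawski1990, §14.2 p. 233] -/
theorem mulConv_map_comp_symm {G G' : Type*} [Group G] [Group G'] [TopologicalSpace G] [TopologicalSpace G']
    [MeasurableSpace G] [MeasurableSpace G'] [BorelSpace G] [BorelSpace G'] (ψ : G ≃ₜ* G') (ν : Measure G) (f k : G → ℂ) :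
    mulConv (ν.map ψ) (f ∘ ψ.symm) (k ∘ ψ.symm) = mulConv ν f k ∘ ψ.symm := by
  funext x
  rw [Function.comp_apply, mulConv_apply, mulConv_apply]
  have hmap : ν.map ψ = ν.map ψ.toHomeomorph.toMeasurableEquiv := by
    rw [Homeomorph.toMeasurableEquiv_coe]; rfl
  rw [hmap, MeasureTheory.integral_map_equiv]
  refine integral_congr_ae (Filter.Eventually.of_forall fun u => ?_)
  show (f ∘ ψ.symm) (ψ.toHomeomorph.toMeasurableEquiv u) * (k ∘ ψ.symm) ((ψ.toHomeomorph.toMeasurableEquiv u)⁻¹ * x) =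
    f u * k (u⁻¹ * ψ.symm x)
  rw [Homeomorph.toMeasurableEquiv_coe]
  show f (ψ.symm (ψ u)) * k (ψ.symm ((ψ u)⁻¹ * x)) = f u * k (u⁻¹ * ψ.symm x)
  rw [ContinuousMulEquiv.symm_apply_apply, map_mul, map_inv, ContinuousMulEquiv.symm_apply_apply]

/-- **THE TWIST COMMUTES WITH THE TRANSPORT** on the finite factors: transporting the twisted tensor along `ψ` gives the twist of the transported
tensor by the TRANSPORTED kernels `k_v ∘ ψ_v⁻¹` w.r.t. the pushed-forward measures `(ψ_v)_* μ_v` — the local content of «a twist of a transfer is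
a transfer of the twist» (`hTw`) once `Transfer` is transport along `ψ`. [cite: Rogawski1990, §13.7 p. 206; §14.2 p. 233] [cite: CartierCorvallis1979, §IV.1] -/
theorem transportAlong_twistAt_loc
    (ψ : ∀ v : HeightOneSpectrum (𝓞 ↥(maximalRealSubfield L)), (cmDatum L N H).Local v ≃ₜ* (cmDatum L N H').Local v)
    (S₀ : Finset (HeightOneSpectrum (𝓞 ↥(maximalRealSubfield L)))) (T : PureTensor L N H)
    (φ' : UnitaryGroup.arch (↥(maximalRealSubfield L)) L (IsCMField.complexConj L) N H' → ℂ)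
    (𝒯 : Finset (HeightOneSpectrum (𝓞 ↥(maximalRealSubfield L))))
    (k : ∀ v : HeightOneSpectrum (𝓞 ↥(maximalRealSubfield L)), (cmDatum L N H).Local v → ℂ)
    (μ : ∀ v : HeightOneSpectrum (𝓞 ↥(maximalRealSubfield L)), @Measure ((cmDatum L N H).Local v) (borel _))
    (v : HeightOneSpectrum (𝓞 ↥(maximalRealSubfield L))) :
    (transportAlong ψ S₀ (twistAt T 𝒯 k μ) φ').loc v =
      (twistAt (transportAlong ψ S₀ T φ') 𝒯 (fun w => k w ∘ (ψ w).symm)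
        (fun w => @Measure.map _ _ (borel _) (borel _) (ψ w) (μ w))).loc v := by
  rw [transportAlong_loc]
  by_cases hv : v ∈ 𝒯
  · rw [twistAt_loc_of_mem T 𝒯 k μ hv, twistAt_loc_of_mem _ 𝒯 _ _ hv, transportAlong_loc]
    letI : MeasurableSpace ((cmDatum L N H).Local v) := borel _
    haveI : BorelSpace ((cmDatum L N H).Local v) := ⟨rfl⟩
    letI : MeasurableSpace ((cmDatum L N H').Local v) := borel _
    haveI : BorelSpace ((cmDatum L N H').Local v) := ⟨rfl⟩
    exact (mulConv_map_comp_symm (ψ v) (μ v) (T.loc v) (k v)).symm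
  · rw [twistAt_loc_of_not_mem T 𝒯 k μ hv, twistAt_loc_of_not_mem _ 𝒯 _ _ hv, transportAlong_loc]

end Summit.HodgeConjecture.HodgeConjecture.R90.S9.PureTensorTwist

end
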